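import Literature.NumberTheory.EllipticCurves.CyclotomicZpExtension
import Literature.NumberTheory.EllipticCurves.ZpExtensionUnitTwistProofs
import Summits.BirchSwinnertonDyer.Rank1Residual.Additive.CyclotomicZpExtensionPrime
import Literature.NumberTheory.EllipticCurves.HasseWeilAbelianEulerFactorFrobenius
import HarnessLib

/-!
# T-E3g-BUDn-K (iv): the two elementary cores of r2's place count D-n.1 — the order of `σ` modulo
# `Gal(K̄/K_n) = κ⁻¹(pⁿℤ_p)` is `p^{n − v_p(κ σ)}`, and the valuation of the normalised logarithm
# `ℓ : ℤ_pˣ → ℤ_p` (`‖ℓ u‖·‖t‖·‖p^{e₀}‖ = ‖u^t − 1‖`) (cell `b2b-bsdres`, n1011, p01 GEN 2)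

HONEST FRAMING (cell `b2b-bsdres`, verbatim in every file): prove what is provable now; nothing is
booked; no label changes. THEOREMS ONLY; NO Literature fact; no `sorry`. r2 ROUTE-2 §II.17.3 D-n.1
(`#{w ∣ l in K_n} = p^{min(n, n_l)}`, `n_l = v_p(l^{p−1} − 1) − 1`, `K = ℚ`, `κ` cyclotomic, `l ≠ p`):
the residue degree of the unramified `l` in the layer `K_n` is the order of `Frob_l` in
`Gal(K_n/K) = Γ_K / κ⁻¹(pⁿℤ_p) ≅ ℤ/pⁿ` — computed here from the `p`-adic valuation `v` of `κ(σ)` as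
`p^{n − v}` (truncated; `orderOf_mk_layerSubgroup`), so that `#{w ∣ l} = pⁿ / p^{n − min(n,v)} =
p^{min(n,v)}` once `e = 1` and `r·e·f = [K_n : K] = pⁿ` (Mathlib
`Ideal.ncard_primesOver_mul_ramificationIdxIn_mul_inertiaDegIn`, the tree's
`Ash2003.orderOf_frobenius_eq_inertiaDeg`) are fed in (NOT here); and `v = n_l`: for the cyclotomic
`κ = u·(ℓ ∘ χ_p)` of `ℚ`, `‖κ(σ)‖ = ‖ℓ(χ_p(σ))‖` (`norm_toAdd_eq_norm_ell_of_isCyclotomic`, from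
`exists_eq_unitTwist_of_kerSubgroup_eq_holds`); with `χ_p(Frob_l) = l`
(`GaloisRep.toZModPow_cyclotomicCharacter_of_isArithFrobAt`, NOT used here) `v_p(κ(Frob_l)) = v_p(ℓ(l))`,
and `norm_ell_mul` gives `v_p(ℓ(u)) = v_p(u^{p−1} − 1) − 1` for odd `p` (`t = p − 1` a unit, `e₀ = 1`).
References: [Washington1997] §13.1; [NeukirchANT1999] I §9; Serre, *A Course in Arithmetic*, II.3.2.
-/

noncomputable section

open Literature.NumberTheory.EllipticCurves Literature.NumberTheory.EllipticCurves.CyclotomicZp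
  Literature.NumberTheory.EllipticCurves.PadicOneUnits Literature.NumberTheory.GaloisRepresentations

universe u

namespace Summit.BirchSwinnertonDyer.Rank1Residual.Additive.ZpTower

section Order

variable {K : Type u} [Field K] {p : ℕ} [Fact p.Prime]

/-- `σ^m ∈ κ⁻¹(pⁿℤ_p) ↔ pⁿ ∣ m·κ(σ)`. [cite: Washington1997, §13.1] -/
theorem pow_mem_layerSubgroup_iff (κ : ZpExtension K p) (n : ℕ) (σ : Field.absoluteGaloisGroup K)
    (m : ℕ) : σ ^ m ∈ κ.layerSubgroup n ↔ (p : ℤ_[p]) ^ n ∣ (m : ℤ_[p]) * (κ σ).toAdd := by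
  rw [ZpExtension.mem_layerSubgroup, map_pow, toAdd_pow, nsmul_eq_mul]

/-- `p^k ∣ (m : ℤ_p) ↔ p^k ∣ m` for natural numbers. [folklore] -/
theorem pow_p_dvd_natCast_iff (k m : ℕ) : (p : ℤ_[p]) ^ k ∣ (m : ℤ_[p]) ↔ p ^ k ∣ m := by
  rw [← Int.cast_natCast (R := ℤ_[p]) m, PadicInt.pow_p_dvd_int_iff, ← Int.natCast_dvd_natCast,
    Nat.cast_pow]

/-- **Order of `σ` modulo `Gal(K̄/K_n)`.** If `κ(σ) = p^v · u` with `u ∈ ℤ_pˣ` then the image of `σ`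
in `Γ_K / κ⁻¹(pⁿℤ_p) = Gal(K_n/K)` has order `p^{n − v}` (truncated subtraction: order `1` when
`v ≥ n`, i.e. `σ` fixes `K_n`). For `σ = Frob_l` this is the residue degree of `l` in `K_n/K`
(Neukirch I (9.4)), whence `#{w ∣ l} = p^{min(n,v)}`. [cite: Washington1997, §13.1]
[cite: NeukirchANT1999, Ch. I §9 Prop. (9.4)] -/
theorem orderOf_mk_layerSubgroup (κ : ZpExtension K p) (n : ℕ) (σ : Field.absoluteGaloisGroup K)
    {v : ℕ} {u : ℤ_[p]} (hu : IsUnit u) (hσ : (κ σ).toAdd = (p : ℤ_[p]) ^ v * u) :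
    orderOf (QuotientGroup.mk (s := κ.layerSubgroup n) σ) = p ^ (n - v) := by
  have hp0 : ∀ k : ℕ, ((p : ℤ_[p]) ^ k) ≠ 0 := fun k =>
    pow_ne_zero k (Nat.cast_ne_zero.mpr (Fact.out : p.Prime).ne_zero)
  have key : ∀ m : ℕ, (QuotientGroup.mk (s := κ.layerSubgroup n) σ) ^ m = 1 ↔ p ^ (n - v) ∣ m := by
    intro m
    rw [← QuotientGroup.mk_pow, QuotientGroup.eq_one_iff, pow_mem_layerSubgroup_iff, hσ,
      ← mul_assoc, hu.dvd_mul_right]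
    rcases Nat.lt_or_ge n v with hnv | hvn
    · rw [Nat.sub_eq_zero_of_le hnv.le, pow_zero]
      simp only [one_dvd, iff_true]
      exact dvd_mul_of_dvd_right (pow_dvd_pow _ hnv.le) _
    · conv_lhs => rw [← Nat.sub_add_cancel hvn, pow_add]
      rw [mul_dvd_mul_iff_right (hp0 v), pow_p_dvd_natCast_iff]
  refine Nat.dvd_antisymm (orderOf_dvd_of_pow_eq_one ((key _).mpr dvd_rfl)) ?_
  exact (key _).mp (pow_orderOf_eq_one _)

/-- The same with the hypothesis in valuation form: if `κ(σ) ≠ 0` has `p`-adic valuation `v`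
(`‖κ σ‖ = p^{-v}`), the order is `p^{n-v}`. [cite: Washington1997, §13.1] -/
theorem orderOf_mk_layerSubgroup_of_norm (κ : ZpExtension K p) (n : ℕ)
    (σ : Field.absoluteGaloisGroup K) {v : ℕ} (hσ : ‖(κ σ).toAdd‖ = (p : ℝ) ^ (-(v : ℤ))) :
    orderOf (QuotientGroup.mk (s := κ.layerSubgroup n) σ) = p ^ (n - v) := by
  have hne : (κ σ).toAdd ≠ 0 := by
    intro h
    rw [h, norm_zero] at hσ
    exact (zpow_pos (by exact_mod_cast (Fact.out : p.Prime).pos) _).ne' hσ.symm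
  obtain ⟨u, hu⟩ : ∃ u : ℤ_[p], (κ σ).toAdd = (p : ℤ_[p]) ^ v * u ∧ IsUnit u := by
    refine ⟨PadicInt.unitCoeff hne, ?_, (PadicInt.unitCoeff hne).isUnit⟩
    have hval : (κ σ).toAdd.valuation = v := by
      have h := PadicInt.norm_eq_zpow_neg_valuation hne
      rw [hσ] at h
      have := zpow_right_injective₀ (by exact_mod_cast (Fact.out : p.Prime).pos)
        (by exact_mod_cast (Fact.out : p.Prime).one_lt.ne') h
      omega
    conv_lhs => rw [PadicInt.unitCoeff_spec hne, hval]
    ring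
  exact orderOf_mk_layerSubgroup κ n σ hu.2 hu.1

end Order

/-! ### The valuation of `ℓ` -/

section Ell

variable (p : ℕ) [Fact p.Prime]

/-- **Valuation of `ℓ`.** `‖ℓ u‖ · ‖t‖ · ‖p^{e₀}‖ = ‖u^t − 1‖` (`t = #μ(ℤ_p)`, `γ_cyc = 1 + p^{e₀}`):
from `γ_cyc^{t·ℓ(u)} = u^t` (`cycPow_torsionOrder_mul_ell`) and `‖γ_cyc^x − 1‖ = ‖x‖·‖p^{e₀}‖`
(`norm_oneAddPow_sub_one`). [cite: Washington1997, §13.1] -/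
theorem norm_ell_mul (u : ℤ_[p]ˣ) :
    ‖ell p u‖ * ‖((torsionOrder p : ℕ) : ℤ_[p])‖ * ‖(p : ℤ_[p]) ^ cyclotomicExponent p‖ =
      ‖(u : ℤ_[p]) ^ torsionOrder p - 1‖ := by
  rw [← cycPow_torsionOrder_mul_ell p u, cycPow,
    norm_oneAddPow_sub_one (cyclotomicExponent p - 1) (cyclotomicExponent_cond p), norm_mul,
    ← cyclotomicExponent_eq_succ p]
  ring
end Ell

/-! ### `‖κ(σ)‖ = ‖ℓ(χ_p(σ))‖` for the cyclotomic `ℤ_p`-extension of `ℚ` -/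

section Cyclotomic

variable (p : ℕ) [Fact p.Prime]

/-- **For the cyclotomic `ℤ_p`-extension `κ` of `ℚ`, `‖κ(σ)‖ = ‖ℓ(χ_p(σ))‖`**: `κ` is a unit
twist of `ℓ ∘ χ_p` (`exists_zpExtension_isCyclotomic_of_coprime ℚ p`, a cyclotomic `ℤ_p`-extension
given by that formula; `exists_eq_unitTwist_of_kerSubgroup_eq_holds`, two `ℤ_p`-extensions with the
same kernel differ by a unit). With `χ_p(Frob_l) = l` and `norm_ell_mul` this is
`v_p(κ(Frob_l)) = n_l` of r2's D-n.1. [cite: Washington1997, §13.1] -/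
theorem norm_toAdd_eq_norm_ell_of_isCyclotomic (κ : ZpExtension ℚ p) (hκ : κ.IsCyclotomic)
    (σ : Field.absoluteGaloisGroup ℚ) :
    ‖(κ σ).toAdd‖ = ‖ell p (GaloisRep.cyclotomicCharacter ℚ p σ)‖ := by
  have hcop : (Module.finrank ℚ ℚ).Coprime p := by
    rw [Module.finrank_self]
    exact Nat.coprime_one_left p
  -- `IsGalois ℚ ℚ` for the `ℚ`-algebra structure the lemma elaborates to (all `ℚ`-algebra
  -- structures on `ℚ` coincide)
  have hG : ∀ inst : Algebra ℚ ℚ, @IsGalois ℚ _ ℚ _ inst := fun inst => by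
    have h : inst = Algebra.id ℚ := Subsingleton.elim _ _
    subst h
    exact IsGalois.self ℚ
  obtain ⟨κ₀, hκ₀, hκ₀apply, -⟩ :=
    @exists_zpExtension_isCyclotomic_of_coprime ℚ _ _ p _ (hG _) hcop
  have hker : κ.kerSubgroup = κ₀.kerSubgroup := by
    unfold ZpExtension.IsCyclotomic at hκ hκ₀
    rw [hκ, hκ₀]
  obtain ⟨u, hu⟩ := κ₀.exists_eq_unitTwist_of_kerSubgroup_eq_holds hker
  rw [hu, ZpExtension.unitTwist_apply, toAdd_ofAdd, norm_mul, hκ₀apply, toAdd_ofAdd,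
    PadicInt.isUnit_iff.mp (Units.isUnit u), one_mul]

end Cyclotomic

/-! ### `v_p(κ(Frob_v))` for the cyclotomic `ℤ_p`-extension of `ℚ` -/

section Frobenius

open scoped NumberField
open IsDedekindDomain

variable (p : ℕ) [Fact p.Prime]

/-- **The valuation of `κ(Frob_v)`, `κ` the cyclotomic `ℤ_p`-extension of `ℚ`, `v ∤ p`:**
`‖κ(σ)‖ · ‖t‖ · ‖p^{e₀}‖ = ‖N(v)^t − 1‖` for any arithmetic Frobenius `σ ∈ Γ_ℚ` at a prime `𝔓 ∣ v`
of `\bar ℤ` — i.e. for odd `p` and `v = (l)`: `v_p(κ(Frob_l)) = v_p(l^{p−1} − 1) − 1 = n_l`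
(r2 ROUTE-2 §II.17.3 D-n.1). From `norm_toAdd_eq_norm_ell_of_isCyclotomic`, `norm_ell_mul` and
`χ_p(σ) = N(v)` (`GaloisRep.toZModPow_cyclotomicCharacter_of_isArithFrobAt`, Serre I-1.2). With
`orderOf_mk_layerSubgroup_of_norm` this gives the residue degree `p^{n − min(n, n_l)}`-part of the
place count. [cite: Washington1997, §13.1] [cite: SerreAbelianLadic1968, Ch. I §1.2] -/
theorem norm_toAdd_frob_mul_of_isCyclotomic (κ : ZpExtension ℚ p) (hκ : κ.IsCyclotomic)
    {v : HeightOneSpectrum (𝓞 ℚ)} (hv : ((p : ℕ) : 𝓞 ℚ) ∉ v.asIdeal)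
    {𝔓 : Ideal (absIntegers (𝓞 ℚ) ℚ)} (h𝔓 : 𝔓 ∈ v.primesAbove)
    {σ : Field.absoluteGaloisGroup ℚ} (hσ : IsArithFrobAt (𝓞 ℚ) σ 𝔓) :
    ‖(κ σ).toAdd‖ * ‖((torsionOrder p : ℕ) : ℤ_[p])‖ * ‖(p : ℤ_[p]) ^ cyclotomicExponent p‖ =
      ‖((v.residueCard : ℕ) : ℤ_[p]) ^ torsionOrder p - 1‖ := by
  have hχ : ((GaloisRep.cyclotomicCharacter ℚ p σ : ℤ_[p]ˣ) : ℤ_[p]) = (v.residueCard : ℤ_[p]) := by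
    refine PadicInt.ext_of_toZModPow.mp fun n => ?_
    rw [GaloisRep.toZModPow_cyclotomicCharacter_of_isArithFrobAt p hv h𝔓 hσ n, map_natCast]
  rw [norm_toAdd_eq_norm_ell_of_isCyclotomic p κ hκ σ, norm_ell_mul, hχ]

end Frobenius

end Summit.BirchSwinnertonDyer.Rank1Residual.Additive.ZpTower

end
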